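/-
Origin: expansion seat `planner-pub-hodgecm-pv08-g5-0`, handover #1 v2 2026-08-18T07:12:50Z doc-relabel (`HOME/pub-hodgecm-pv08-g5/lean/Pv08g5/S5QautSeesaw.lean`, md5 04f31e15, 498 lines);
landed by the gen-7 packager in gate run 25 as `HodgeCM/PerL34/S5QautSeesaw.lean` (verbatim).
-/
/-
Origin: HOME/pub-hodgecm-pv08-g5/lean/Pv08g5/S5QautSeesaw.lean — session planner-pub-hodgecm-pv08-g5-0 (unit
pub-hodgecm-pv08-g5, DAG-NODE PROVER #08 gen 5; successor of pv08 / pv08-g2 / pv08-g3 / pv08-g4).  LEMMAS.md v10 §9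
**seam S5**, `N19g` / (34)-half.  Intended final place: `HodgeCM/PerL34/S5QautSeesaw.lean`, after the RUN-24 file
`HodgeCM/PerL34/S5QautFock.lean` (pv08-g4) and the LANDED `HodgeCM/PerL34/SeesawWedge.lean` (pv11, run 20);
imports `HodgeCM.*` only, no rewrite needed.  New namespace `HodgeCM.PerL34.QautSeesaw`.  Asserts nothing: no
axiom, no placeholder proof; every field of the record is labelled SHELL / STRUCTURAL / DEFINITIONAL / DICTIONARY /
PRINT below; nothing is cited as a fact.
-/
import Summits.HodgeConjecture.HodgeCM.PerL34.S5QautFock_2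
import Summits.HodgeConjecture.HodgeCM.PerL34.SeesawWedge

/-!
# Seam S5, `N19g` half, on pv11's lattice shell: (eq:seesaw)-on-pure-tensors and the `K`-type transport of the
# theta maps become KERNEL

## What pv08-g4's record still posits

`QautFock.QautFockBridge T V c D k l` (`S5QautFock.lean`, run 24) derives pv08's leaf `S12Wedges.N19g_core` (the
finite-sum core of PerL v5 Lemma 3.5 `lem:S12`, tex ll. 356–372, side `(k,l)`, torus data `D`) from a record in which
the `K_{ι₁}`-type list of `J⁺` and the `U(1)`-weight count are KERNEL, but which still carries TWO sentences of the tex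
as DICTIONARY fields about the (otherwise unspecified) theta maps `Ψ₁ χ, Ψ₂ χ : Set (J⁺ →ₗ C)`:
  (i)  `seesawPure` — (eq:seesaw) on pure tensors, l. 360–362: `ϑ_{T',χ}(pr_κ(φ₁⊗φ₂)) = pr_κ(θ(φ₁,χ'₁) θ(φ₂,χ'₂))`,
       summed over the pure tensors making up `Φ ∈ P` (node N17 for the side);
  (ii) `equiv₁/equiv₂` — `K`-type transport, l. 362–363: "`θ(φ_j,χ'_j) ∈ π_j` has the `K_∞`-type of `φ_j`", typed as
       `σ x (ψ p) = ψ (Jplus (κ x) p)`.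

## What this file does

It places the (34)-half on the SAME posited lattice-sum shell `Seesaw.ThetaSeesawData` (pv11, `Seesaw.lean`, run 20)
that already carries the (12)-half record `SeesawDictionary.SeesawBridge` (run 22), and DERIVES (i) and (ii):

* `QautSeesawBridge T V c D k l` (§3): pv08-g4's archimedean shell (`K, μ, C, σ, κ, k₀, d₀, toHG, P, dense`) + pv11's
  shell `DS` with EXACTLY the N17 hypotheses of the landed `SeesawWedge.genIdentity_core` / `SeesawBridge`
  (`omegaSub, evSub, evalTmul, restrictTmul, absSummable₁, absSummable₂`, integrability on the compact `[U(W_j)]`,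
  l. 335), plus
  - STRUCTURAL (D5, the sentence "`C` = bounded right-uniformly continuous functions on `G_U(L₀)\G_U(𝔸)`, `K_∞` acting
    by right translation", PerL §3.1 l. 246 / (Qaut) shell of `QautWedge`): an INJECTIVE algebra homomorphism
    `evalC : C →ₐ[ℂ] (G_U(𝔸) → ℂ)` with `evalC (σ x f) g = evalC f (g·x)` (`ract x g = g·x`);
  - STRUCTURAL (D4, "`ω_{W_j,μ_j}` is a representation of `G_U(𝔸) × U(W_j)(𝔸)`", l. 261): `ω_j(g·x, u) = ω_j(g,u) ∘ ω_j(x)`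
    for `x ∈ K_∞ ⊂ G_U(𝔸)` (`omega_ract₁/₂`, with `ωK_j x = ω_j(x,1)` on `𝒮((V₃⊗W_j)(𝔸))`);
  - DICTIONARY (D5 — THE Fock sentence, now on the SCHWARTZ side where PerL states it, l. 358–360 "in the Fock model
    at `ι₁` … `φ_j = p_j ⊗ φ_j^{ι₁}`"; MODEL CAVEAT (F1)/(F2) of `P43_KTypesFock`): `emb_j a p = p ⊗ a ∈ 𝒮_j` for a Fock
    polynomial `p ∈ J⁺` and ADMISSIBLE data `a` away from `ι₁` (`κ`-typed, i.e. `K_ι`-invariant at the definite places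
    `ι ≠ ι₁`, fixed at the finite places), on which `K_∞` acts through `K_{ι₁} = U(2) × U(1)` on the Fock factor:
    `ω_j(x)(p ⊗ a) = (Jplus (κ x) p) ⊗ a` (`emb_equiv₁/₂`);
  - DEFINITIONAL (D4): the theta lifts and torus periods of the shell ARE these elements of `C`:
    `evalC (thetaJ_j χ a p) = θ(p ⊗ a, χ'_j)` (pv11 `thetaLift_j`), `evalC (periodC χ Φ') = ϑ_{T',χ}(Φ')` (pv11
    `thetaPeriod`), the characters `χ'_j = ch_j χ` of `χ = χ'₁ ⊠ χ'₂ ∈ D.X` (D1);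
  - DICTIONARY (D4 + ll. 362–364 + l. 372/374): `ϑ_pr` — for `Φ ∈ P`, `D.ϑ χ Φ = [pr_κ ϑ_{T',χ}(Φ')]` where `Φ'` is a
    finite sum of pure tensors `(p₁ ⊗ a₁) ⊗ (p₂ ⊗ a₂)` with admissible `a_j` — the `J⁺⊠𝟏`-typed PART of a Fock expansion
    of (a `pr_κ`-preimage of) `Φ`; the remaining pure types lift to `0` (ll. 362–364: "θ(φ_j,χ'_j) … vanishes unless that type
    occurs in J⁺⊠𝟏" = the `U(1)`-weight tautology, KERNEL in the package as `ArchA.LineArchData.N27_converse` given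
    `LocMatches χ'_j`, r19) and `pr_κ` commutes with `ϑ_{T,χ}` (l. 372).  NOT claimed (and false for a dense `P`, since
    `Σ₁₂ ≠ ∅`, l. 289, and `𝓕^κ_b = ℂ[P]` at `b ∈ Σ₁₂`, ll. 502–505): that `Φ` itself is `pr_κ` of admissible pure tensors
    (adv2g12-O4, GAPS l. 4411, repair (i));
  - DICTIONARY `wedge_mem` (D2 + (Qaut) §3.1 + Lemma 3.3(a); as in pv08-g4's record) and PRINT `dense` (density of
    `K`-finite vectors) — unchanged.
* KERNEL (§1–§2, over pv11's shell): `ω` and evaluation are ADDITIVE (from pv11's `OmegaSub`/`EvSub`), the theta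
  kernel and the torus period are additive over finite sums of absolutely summable / integrable vectors
  (`thetaKernel_sum`, `thetaPeriod_sum`), the theta kernel of `ω(x)φ` is the right translate of that of `φ`
  (`thetaKernel₁_ωK`, `thetaLift₁_ωK`), and — pv11's `eq_seesaw`, i.e. Fubini on `[T'] = [U(W₃)] × [U(W₄)]` +
  multiplicativity of the lattice sums — `ϑ_{T',χ}(Σ_i φ₁ⁱ⊗φ₂ⁱ) = Σ_i θ(φ₁ⁱ,χ'₁) θ(φ₂ⁱ,χ'₂)` (`thetaPeriod_sum_tmul`).
* §4 `QautSeesawBridge.toFockBridge : QautSeesawBridge T V c D k l → QautFock.QautFockBridge T V c D k l` with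
  `Ψ_j χ := {thetaJ_j χ a | a admissible}`: field `equiv_j` DERIVED (`sigma_thetaJ₁/₂`: `evalC`-injectivity +
  `omega_ract` + `emb_equiv`), field `seesawPure` DERIVED (`periodC_sum_tmul`: `evalC`-injectivity + additivity +
  `eq_seesaw` termwise, then pv02's linear `prL`); corollaries `N19g_core_of_seesawBridge`,
  `nonempty_fockBridge_of_seesawBridge`, `N19_genIn_of_seesawBridge`, `open_thetaReal34_of_seesawBridges`.

Net effect on the S5 record (LEMMAS §9): both halves of S5 now sit on ONE lattice shell; in the (34)-half the fields
with PerL-internal content are `wedge_mem` [D2 + (Qaut) + L3.3(a)], `ϑ_pr` [D4 + ll. 362–364 (vanishing of non-`J⁺⊠𝟏`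
types; kernel as `ArchA.N27_converse`) + l. 372 "`pr_κ` commutes with `ϑ`"], `dense`
[PRINT] and pv11's `restrictTmul` [PRINT-DERIVED: HKS JAMS 9 (1996) (1.13)–(1.16) p. 952, Cor. A.3 p. 998; Ku94 §1] —
(eq:seesaw) itself and the `K`-type transport are COMPUTED, not posited.

STRENGTH.  `Nonempty (QautSeesawBridge …) → Nonempty (QautFockBridge …) ↔ N19g_core …` (this file + pv08-g4
`S5QautFockConservative.nonempty_fockBridge_iff`).  Conservativity of THIS record over the leaf is NOT proved here
(recorded as open in HOME/GAPS.md `## pub-hodgecm-pv08-g5`).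

Unit `pub-hodgecm-pv08-g5`, 2026-08-18.  Fully kernel-checked; standard axiom trio.
-/

set_option autoImplicit false

noncomputable section

open MeasureTheory Matrix
open HodgeCM.Prior.Perl34File
open HodgeCM.PerL34.Qaut (pr prL prL_apply wedge)
open HodgeCM.PerL34.P43KTypesU2 (Jplus diagK jplusSubmodule)
open HodgeCM.PerL34.QautFock (pPlusMat continuous_pPlusMat isUnit_det_pPlusMat formOf QautFockBridge
  N19g_core_of_fockBridge nonempty_qautBridge_of_fockBridge N19_genIn_of_fockBridge open_thetaReal34_of_fockBridges)
open HodgeCM.PerL34.Seesaw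

namespace HodgeCM
namespace PerL34
namespace QautSeesaw

/-! ## §1. Additivity of the posited Weil action and evaluation (from pv11's `OmegaSub` / `EvSub`) -/

section Shell

variable (DS : ThetaSeesawData) [AddCommGroup DS.S]

/-- (Ported verbatim from the HodgeCMPerL package; no docstring in the source.) -/
theorem omega_zero (hΩ : DS.OmegaSub) (g : DS.G) (t : DS.A₁ × DS.A₂) : DS.ωW g t 0 = 0 := by
  have h := hΩ g t 0 0
  rwa [sub_self, sub_self] at h

/-- (Ported verbatim from the HodgeCMPerL package; no docstring in the source.) -/
theorem omega_neg (hΩ : DS.OmegaSub) (g : DS.G) (t : DS.A₁ × DS.A₂) (Φ : DS.S) :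
    DS.ωW g t (-Φ) = -DS.ωW g t Φ := by
  have h := hΩ g t 0 Φ
  rwa [zero_sub, omega_zero DS hΩ, zero_sub] at h

/-- (Ported verbatim from the HodgeCMPerL package; no docstring in the source.) -/
theorem omega_add (hΩ : DS.OmegaSub) (g : DS.G) (t : DS.A₁ × DS.A₂) (Φ Φ' : DS.S) :
    DS.ωW g t (Φ + Φ') = DS.ωW g t Φ + DS.ωW g t Φ' := by
  have h := hΩ g t Φ (-Φ')
  rwa [sub_neg_eq_add, omega_neg DS hΩ, sub_neg_eq_add] at h

/-- (Ported verbatim from the HodgeCMPerL package; no docstring in the source.) -/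
theorem ev_zero (hV : DS.EvSub) (z : DS.X₁ × DS.X₂) : DS.ev 0 z = 0 := by
  have h := hV 0 0 z
  rwa [sub_self, sub_self] at h

/-- (Ported verbatim from the HodgeCMPerL package; no docstring in the source.) -/
theorem ev_neg (hV : DS.EvSub) (Φ : DS.S) (z : DS.X₁ × DS.X₂) : DS.ev (-Φ) z = -DS.ev Φ z := by
  have h := hV 0 Φ z
  rwa [zero_sub, ev_zero DS hV, zero_sub] at h

/-- (Ported verbatim from the HodgeCMPerL package; no docstring in the source.) -/
theorem ev_add (hV : DS.EvSub) (Φ Φ' : DS.S) (z : DS.X₁ × DS.X₂) :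
    DS.ev (Φ + Φ') z = DS.ev Φ z + DS.ev Φ' z := by
  have h := hV Φ (-Φ') z
  rwa [sub_neg_eq_add, ev_neg DS hV, sub_neg_eq_add] at h

/-! ## §2. KERNEL: theta kernels and torus periods over finite sums of pure tensors -/

/-- `θ_0 = 0`. -/
theorem thetaKernel_zero (hΩ : DS.OmegaSub) (hV : DS.EvSub) (g : DS.G) (t : DS.A₁ × DS.A₂) :
    DS.thetaKernel 0 g t = 0 := by
  simp only [ThetaSeesawData.thetaKernel, omega_zero DS hΩ, ev_zero DS hV, tsum_zero]

/-- `θ_{Φ+Φ'} = θ_Φ + θ_{Φ'}` for absolutely convergent theta series. -/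
theorem thetaKernel_add (hΩ : DS.OmegaSub) (hV : DS.EvSub) {Φ Φ' : DS.S} {g : DS.G} {t : DS.A₁ × DS.A₂}
    (hΦ : Summable fun z => DS.ev (DS.ωW g t Φ) z) (hΦ' : Summable fun z => DS.ev (DS.ωW g t Φ') z) :
    DS.thetaKernel (Φ + Φ') g t = DS.thetaKernel Φ g t + DS.thetaKernel Φ' g t := by
  simp only [ThetaSeesawData.thetaKernel, omega_add DS hΩ, ev_add DS hV]
  exact hΦ.tsum_add hΦ'

/-- Summability and additivity of the theta kernel over a finite sum of vectors with absolutely convergent theta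
series. -/
theorem thetaKernel_sum (hΩ : DS.OmegaSub) (hV : DS.EvSub) {ι : Type*} (s : Finset ι) (Φ : ι → DS.S)
    (hs : ∀ i ∈ s, ∀ (g : DS.G) (t : DS.A₁ × DS.A₂), Summable fun z => DS.ev (DS.ωW g t (Φ i)) z) :
    (∀ (g : DS.G) (t : DS.A₁ × DS.A₂), Summable fun z => DS.ev (DS.ωW g t (∑ i ∈ s, Φ i)) z) ∧
      ∀ (g : DS.G) (t : DS.A₁ × DS.A₂), DS.thetaKernel (∑ i ∈ s, Φ i) g t = ∑ i ∈ s, DS.thetaKernel (Φ i) g t := by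
  induction s using Finset.cons_induction with
  | empty =>
    refine ⟨fun g t => ?_, fun g t => ?_⟩
    · rw [Finset.sum_empty, omega_zero DS hΩ]
      simp only [ev_zero DS hV]
      exact summable_zero
    · rw [Finset.sum_empty, Finset.sum_empty, thetaKernel_zero DS hΩ hV]
  | cons a s ha ih =>
    obtain ⟨ih₁, ih₂⟩ := ih fun i hi => hs i (Finset.mem_cons_of_mem hi)
    have ha' := hs a (Finset.mem_cons_self a s)
    refine ⟨fun g t => ?_, fun g t => ?_⟩
    · rw [Finset.sum_cons, omega_add DS hΩ]
      simp only [ev_add DS hV]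
      exact (ha' g t).add (ih₁ g t)
    · rw [Finset.sum_cons, Finset.sum_cons, thetaKernel_add DS hΩ hV (ha' g t) (ih₁ g t), ih₂ g t]

variable [MeasurableSpace DS.A₁] [MeasurableSpace DS.A₂] (ν₁ : Measure DS.A₁) (ν₂ : Measure DS.A₂)

/-- `ϑ_{T,χ}(Σ_i Φ_i) = Σ_i ϑ_{T,χ}(Φ_i)` when every theta series converges absolutely and every integrand is
integrable on `[T]`. -/
theorem thetaPeriod_sum (hΩ : DS.OmegaSub) (hV : DS.EvSub) (χ₁ : DS.A₁ → ℂ) (χ₂ : DS.A₂ → ℂ) {ι : Type*}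
    (s : Finset ι) (Φ : ι → DS.S)
    (hs : ∀ i ∈ s, ∀ (g : DS.G) (t : DS.A₁ × DS.A₂), Summable fun z => DS.ev (DS.ωW g t (Φ i)) z)
    (hI : ∀ i ∈ s, ∀ g : DS.G,
      Integrable (fun t => DS.thetaKernel (Φ i) g t * (χ₁ t.1 * χ₂ t.2)) (ν₁.prod ν₂)) (g : DS.G) :
    DS.thetaPeriod ν₁ ν₂ χ₁ χ₂ (∑ i ∈ s, Φ i) g = ∑ i ∈ s, DS.thetaPeriod ν₁ ν₂ χ₁ χ₂ (Φ i) g := by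
  simp only [ThetaSeesawData.thetaPeriod]
  have h : (fun t => DS.thetaKernel (∑ i ∈ s, Φ i) g t * (χ₁ t.1 * χ₂ t.2)) =
      fun t => ∑ i ∈ s, DS.thetaKernel (Φ i) g t * (χ₁ t.1 * χ₂ t.2) := by
    funext t
    rw [(thetaKernel_sum DS hΩ hV s Φ hs).2 g t, Finset.sum_mul]
  rw [h, integral_finsetSum s fun i hi => hI i hi g]

omit [AddCommGroup DS.S] in
/-- The integrand of `ϑ_{T,χ}(φ₁ ⊗ φ₂)` is integrable on `[T] = [U(W₁)] × [U(W₂)]` as soon as the two factors are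
(pv11's `thetaKernel_tmul` + `Integrable.mul_prod`; PerL l. 335). -/
theorem integrable_tmul (hE : DS.EvalTmul) (hR : DS.RestrictTmul) (hS₁ : DS.AbsSummable₁) (hS₂ : DS.AbsSummable₂)
    (χ₁ : DS.A₁ → ℂ) (χ₂ : DS.A₂ → ℂ) (φ₁ : DS.S₁) (φ₂ : DS.S₂) (g : DS.G)
    (h₁ : Integrable (fun u => DS.thetaKernel₁ φ₁ g u * χ₁ u) ν₁)
    (h₂ : Integrable (fun u => DS.thetaKernel₂ φ₂ g u * χ₂ u) ν₂) :
    Integrable (fun t => DS.thetaKernel (DS.tmul φ₁ φ₂) g t * (χ₁ t.1 * χ₂ t.2)) (ν₁.prod ν₂) := by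
  refine (h₁.mul_prod h₂).congr (Filter.Eventually.of_forall fun t => ?_)
  simp only [DS.thetaKernel_tmul hE hR hS₁ hS₂]
  ring

/-- **(eq:seesaw) summed over finitely many pure tensors (KERNEL, node N17 for the side):**
`ϑ_{T',χ}(Σ_i φ₁ⁱ ⊗ φ₂ⁱ)(g) = Σ_i θ(φ₁ⁱ,χ'₁)(g) θ(φ₂ⁱ,χ'₂)(g)`. -/
theorem thetaPeriod_sum_tmul [SFinite ν₁] [SFinite ν₂] (hΩ : DS.OmegaSub) (hV : DS.EvSub) (hE : DS.EvalTmul)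
    (hR : DS.RestrictTmul) (hS₁ : DS.AbsSummable₁) (hS₂ : DS.AbsSummable₂) (χ₁ : DS.A₁ → ℂ) (χ₂ : DS.A₂ → ℂ)
    {ι : Type*} (s : Finset ι) (φ₁ : ι → DS.S₁) (φ₂ : ι → DS.S₂)
    (h₁ : ∀ i ∈ s, ∀ g : DS.G, Integrable (fun u => DS.thetaKernel₁ (φ₁ i) g u * χ₁ u) ν₁)
    (h₂ : ∀ i ∈ s, ∀ g : DS.G, Integrable (fun u => DS.thetaKernel₂ (φ₂ i) g u * χ₂ u) ν₂) (g : DS.G) :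
    DS.thetaPeriod ν₁ ν₂ χ₁ χ₂ (∑ i ∈ s, DS.tmul (φ₁ i) (φ₂ i)) g =
      ∑ i ∈ s, DS.thetaLift₁ ν₁ χ₁ (φ₁ i) g * DS.thetaLift₂ ν₂ χ₂ (φ₂ i) g := by
  rw [thetaPeriod_sum DS ν₁ ν₂ hΩ hV χ₁ χ₂ s (fun i => DS.tmul (φ₁ i) (φ₂ i))
    (fun i _ g' t => DS.summable_ev_tmul hE hR hS₁ hS₂ _ _ _ _)
    (fun i hi g' => integrable_tmul DS ν₁ ν₂ hE hR hS₁ hS₂ χ₁ χ₂ _ _ g' (h₁ i hi g') (h₂ i hi g')) g]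
  refine Finset.sum_congr rfl fun i _ => ?_
  rw [DS.eq_seesaw ν₁ ν₂ hE hR hS₁ hS₂]

end Shell

/-! ## §3. The S5 record, `N19g` half, over the lattice shell -/

variable {U : Universe} (T : U.ThetaModel)
variable {L : CMField} {ι₁ : L →+* ℂ} (V : HermSpace3 L ι₁) (c : SeesawCtx L)
variable (D : Perl34.TorusData (T.core V c)) (k l : Fin 4)

/-- **The S5 bridge record, `N19g` half, over pv11's lattice shell and pv12/pv14's Fock `J⁺`-piece.**  See the module
docstring for the label of every field.  Compared with `QautFock.QautFockBridge` the fields `Ψ₁, Ψ₂, equiv₁, equiv₂,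
seesawPure` are GONE (defined / derived in §4); new are the shell `DS` with its N17 hypotheses, the function-algebra
structure `evalC`, the `K_∞`-action on the shell (`ract`, `ωK_j`, `omega_ract_j`), the Fock sentence `emb_equiv_j`,
the named theta lifts / periods `thetaJ_j`, `periodC` and the one dictionary field `ϑ_pr`. -/
structure QautSeesawBridge where
  /-- SHELL (D5): `K_∞` -/
  K : Type
  [instK₁ : Group K]
  [instK₂ : TopologicalSpace K]
  [instK₃ : IsTopologicalGroup K]
  [instK₄ : MeasurableSpace K]
  [instK₅ : BorelSpace K]
  [instK₆ : CompactSpace K]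
  /-- its Haar probability measure -/
  μ : Measure K
  [instμ₁ : IsProbabilityMeasure μ]
  [instμ₂ : μ.IsMulLeftInvariant]
  [instμ₃ : μ.IsMulRightInvariant]
  /-- SHELL (D5): the commutative Banach algebra of bounded right-uniformly continuous functions on `G_U(L₀)\G_U(𝔸)` -/
  C : Type
  [instC₁ : NormedCommRing C]
  [instC₂ : NormedAlgebra ℂ C]
  [instC₃ : CompleteSpace C]
  /-- right translation by `K_∞` (algebra automorphisms), strongly continuous -/
  σ : K →* (C →ₐ[ℂ] C)
  σ_cont : ∀ f : C, Continuous fun x => σ x f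
  /-- DICTIONARY (D2): the projection `K_∞ → K_{ι₁} = U(2) × U(1)` -/
  κ : K →* P43KTypesU2.K
  κ_cont : Continuous κ
  /-- DICTIONARY (D2: `K_{ι₁}` is a direct factor of `K_∞`): a torus element with distinct `𝔭₊`-weights and a Weyl
  element lie in the image -/
  ρ_diag : ∃ x s t, s ≠ t ∧ pPlusMat (κ x) = !![s, 0; 0, t]
  ρ_antidiag : ∃ x a b, pPlusMat (κ x) = !![0, a; b, 0]
  /-- the central `U(1)_V`: `κ k₀ = (1₂, d₀)`, `d₀` of infinite order -/
  k₀ : K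
  d₀ : unitary ℂ
  κ_k₀ : κ k₀ = diagK 1 1 d₀
  d₀_pow_ne_one : ∀ m : ℕ, 1 ≤ m → (d₀ : ℂ) ^ m ≠ 1
  /-- DICTIONARY (D5): the `L²` class of a function of the shell -/
  toHG : C →ₗ[ℂ] T.HG L ι₁ V
  /-- SETUP (D4′): pv11's lattice shell `(G_U(𝔸), U(W_j)(𝔸), (V₃⊗W_j)(L₀), 𝒮, ω, ev, ⊗)` for the pair of lines of
  the side (`W₃, W₄` for the (34) side) -/
  DS : ThetaSeesawData
  [instS : AddCommGroup DS.S]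
  [instA₁ : MeasurableSpace DS.A₁]
  [instA₂ : MeasurableSpace DS.A₂]
  /-- Haar probability measures of `[U(W_j)]` -/
  ν₁ : Measure DS.A₁
  ν₂ : Measure DS.A₂
  [sf₁ : SFinite ν₁]
  [sf₂ : SFinite ν₂]
  /-- N17 hypotheses, exactly as in the landed `SeesawWedge.genIdentity_core` / `SeesawDictionary.SeesawBridge` -/
  omegaSub : DS.OmegaSub
  evSub : DS.EvSub
  evalTmul : DS.EvalTmul
  restrictTmul : DS.RestrictTmul
  absSummable₁ : DS.AbsSummable₁
  absSummable₂ : DS.AbsSummable₂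
  /-- STRUCTURAL (D5): `C` is an algebra of functions on `G_U(𝔸)` — an injective algebra homomorphism -/
  evalC : C →ₐ[ℂ] (DS.G → ℂ)
  evalC_injective : Function.Injective evalC
  /-- STRUCTURAL (D5): right translation of `G_U(𝔸)` by `K_∞ ⊂ G_U(𝔸)`, and `σ` IS right translation -/
  ract : K → DS.G → DS.G
  evalC_sigma : ∀ (x : K) (f : C) (g : DS.G), evalC (σ x f) g = evalC f (ract x g)
  /-- STRUCTURAL (D4): `ω_{W_j}(x) := ω_{W_j,μ_j}(x, 1)` for `x ∈ K_∞`, and `ω_{W_j}` is a representation: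
  `ω_j(g·x, u) = ω_j(g, u) ∘ ω_j(x)` -/
  ωK₁ : K → DS.S₁ → DS.S₁
  ωK₂ : K → DS.S₂ → DS.S₂
  omega_ract₁ : ∀ (x : K) (g : DS.G) (u : DS.A₁) (φ : DS.S₁), DS.ω₁ (ract x g) u φ = DS.ω₁ g u (ωK₁ x φ)
  omega_ract₂ : ∀ (x : K) (g : DS.G) (u : DS.A₂) (φ : DS.S₂), DS.ω₂ (ract x g) u φ = DS.ω₂ g u (ωK₂ x φ)
  /-- DICTIONARY (D1): the two components `χ'_j` of a character `χ = χ'₁ ⊠ χ'₂ ∈ D.X` of `[T']` -/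
  ch₁ : D.X → (DS.A₁ → ℂ)
  ch₂ : D.X → (DS.A₂ → ℂ)
  /-- D1/D4: the Schwartz data AWAY from `ι₁` (definite archimedean places and finite places) and its admissibility
  for `χ` ("`κ`-typed", "of type `Ψ_j`") — an opaque predicate of the dictionary -/
  Away₁ : Type
  Away₂ : Type
  Adm₁ : D.X → Away₁ → Prop
  Adm₂ : D.X → Away₂ → Prop
  /-- DICTIONARY (D5, the Fock sentence): `p ⊗ a ∈ 𝒮((V₃⊗W_j)(𝔸))` for a Fock polynomial `p ∈ J⁺` at `ι₁` -/
  emb₁ : Away₁ → jplusSubmodule → DS.S₁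
  emb₂ : Away₂ → jplusSubmodule → DS.S₂
  /-- DICTIONARY (D5): `K_∞` acts on `p ⊗ a`, `a` admissible, through `K_{ι₁}` on the Fock factor -/
  emb_equiv₁ : ∀ χ a, Adm₁ χ a → ∀ (x : K) (p : jplusSubmodule), ωK₁ x (emb₁ a p) = emb₁ a (Jplus (κ x) p)
  emb_equiv₂ : ∀ χ a, Adm₂ χ a → ∀ (x : K) (p : jplusSubmodule), ωK₂ x (emb₂ a p) = emb₂ a (Jplus (κ x) p)
  /-- PerL l. 335: `u ↦ θ_{p⊗a}(g,u) χ'_j(u)` is integrable on the compact `[U(W_j)]` -/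
  integrable₁ : ∀ χ a, Adm₁ χ a → ∀ (p : jplusSubmodule) (g : DS.G),
    Integrable (fun u => DS.thetaKernel₁ (emb₁ a p) g u * ch₁ χ u) ν₁
  integrable₂ : ∀ χ a, Adm₂ χ a → ∀ (p : jplusSubmodule) (g : DS.G),
    Integrable (fun u => DS.thetaKernel₂ (emb₂ a p) g u * ch₂ χ u) ν₂
  /-- DEFINITIONAL (D4): the theta map `p ↦ θ(p ⊗ a, χ'_j)` as an element of `C` — it IS pv11's `thetaLift_j` -/
  thetaJ₁ : D.X → Away₁ → (jplusSubmodule →ₗ[ℂ] C)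
  thetaJ₂ : D.X → Away₂ → (jplusSubmodule →ₗ[ℂ] C)
  evalC_thetaJ₁ : ∀ χ a (p : jplusSubmodule), evalC (thetaJ₁ χ a p) = DS.thetaLift₁ ν₁ (ch₁ χ) (emb₁ a p)
  evalC_thetaJ₂ : ∀ χ a (p : jplusSubmodule), evalC (thetaJ₂ χ a p) = DS.thetaLift₂ ν₂ (ch₂ χ) (emb₂ a p)
  /-- DEFINITIONAL (D4): the torus period `ϑ_{T',χ}(Φ')` of a shell vector as an element of `C` — it IS pv11's
  `thetaPeriod` -/
  periodC : D.X → DS.S → C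
  evalC_periodC : ∀ χ (Φ' : DS.S), evalC (periodC χ Φ') = DS.thetaPeriod ν₁ ν₂ (ch₁ χ) (ch₂ χ) Φ'
  /-- DICTIONARY (D2 + (Qaut) §3.1 + Lemma 3.3(a); l. 371–372, ll. 655–657): the wedge of the canonical theta
  one-forms of an allowed character is a `(k,l)`-wedge-function of the model -/
  wedge_mem : ∀ χ, D.allowed χ → ∀ a₁, Adm₁ χ a₁ → ∀ a₂, Adm₂ χ a₂ →
    toHG (wedge (formOf (thetaJ₁ χ a₁)) (formOf (thetaJ₂ χ a₂))) ∈ T.wedgeSet V c k l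
  /-- D4 + PRINT (density of `K`-finite vectors): the dense subspace `P = pr_κ(𝒫) ⊆ 𝒮^κ` -/
  P : Set (T.SK V c)
  dense : Dense P
  /-- DICTIONARY (D4 + ll. 362–364 + l. 372): for `Φ ∈ P`, `D.ϑ χ Φ = pr_κ ϑ_{T',χ}(Φ')` with
  `Φ' = Σ_i (p₁ⁱ⊗a₁ⁱ) ⊗ (p₂ⁱ⊗a₂ⁱ)`, `a_jⁱ` admissible = the `J⁺⊠𝟏`-typed part of a Fock expansion of (a `pr_κ`-preimage
  of) `Φ`; the other pure types lift to `0` (ll. 362–364, the `U(1)`-weight tautology; kernel as `ArchA.N27_converse` given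
  `LocMatches χ'_j`) and `pr_κ` commutes with `ϑ_{T,χ}` (l. 372).  It is NOT asserted that `Φ` is `pr_κ` of admissible pure
  tensors (false for dense `P`: adv2g12-O4). -/
  ϑ_pr : ∀ χ, D.allowed χ → ∀ Φ ∈ P, ∃ (n : ℕ) (a₁ : Fin n → Away₁) (a₂ : Fin n → Away₂)
    (p₁ p₂ : Fin n → jplusSubmodule), (∀ i, Adm₁ χ (a₁ i) ∧ Adm₂ χ (a₂ i)) ∧
      D.ϑ χ Φ = toHG (pr μ (pPlusMat.comp κ) σ
        (periodC χ (∑ i, DS.tmul (emb₁ (a₁ i) (p₁ i)) (emb₂ (a₂ i) (p₂ i)))))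

attribute [instance] QautSeesawBridge.instK₁ QautSeesawBridge.instK₂ QautSeesawBridge.instK₃
  QautSeesawBridge.instK₄ QautSeesawBridge.instK₅ QautSeesawBridge.instK₆ QautSeesawBridge.instμ₁
  QautSeesawBridge.instμ₂ QautSeesawBridge.instμ₃ QautSeesawBridge.instC₁ QautSeesawBridge.instC₂
  QautSeesawBridge.instC₃ QautSeesawBridge.instS QautSeesawBridge.instA₁ QautSeesawBridge.instA₂
  QautSeesawBridge.sf₁ QautSeesawBridge.sf₂

namespace QautSeesawBridge

variable {T V c D k l}
variable (R : QautSeesawBridge T V c D k l)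

/-! ## §4. The derived fields and the constructor -/

/-- The theta maps of side 1 (resp. 2) at `χ`: `p ↦ θ(p ⊗ a, χ'_j)`, `a` admissible (DEFINED, not posited). -/
def Ψ₁ (χ : D.X) : Set (jplusSubmodule →ₗ[ℂ] R.C) := {ψ | ∃ a, R.Adm₁ χ a ∧ ψ = R.thetaJ₁ χ a}

/-- see `Ψ₁` -/
def Ψ₂ (χ : D.X) : Set (jplusSubmodule →ₗ[ℂ] R.C) := {ψ | ∃ a, R.Adm₂ χ a ∧ ψ = R.thetaJ₂ χ a}

/-- KERNEL: the theta kernel of `ω(x)φ` is the right `x`-translate of that of `φ` (`ω` is a representation). -/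
theorem thetaKernel₁_ωK (x : R.K) (φ : R.DS.S₁) (g : R.DS.G) (u : R.DS.A₁) :
    R.DS.thetaKernel₁ (R.ωK₁ x φ) g u = R.DS.thetaKernel₁ φ (R.ract x g) u := by
  simp only [ThetaSeesawData.thetaKernel₁, R.omega_ract₁]

/-- (Ported verbatim from the HodgeCMPerL package; no docstring in the source.) -/
theorem thetaKernel₂_ωK (x : R.K) (φ : R.DS.S₂) (g : R.DS.G) (u : R.DS.A₂) :
    R.DS.thetaKernel₂ (R.ωK₂ x φ) g u = R.DS.thetaKernel₂ φ (R.ract x g) u := by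
  simp only [ThetaSeesawData.thetaKernel₂, R.omega_ract₂]

/-- KERNEL: `θ(ω(x)φ, χ')(g) = θ(φ, χ')(g·x)`. -/
theorem thetaLift₁_ωK (χ₁ : R.DS.A₁ → ℂ) (x : R.K) (φ : R.DS.S₁) (g : R.DS.G) :
    R.DS.thetaLift₁ R.ν₁ χ₁ (R.ωK₁ x φ) g = R.DS.thetaLift₁ R.ν₁ χ₁ φ (R.ract x g) := by
  simp only [ThetaSeesawData.thetaLift₁, R.thetaKernel₁_ωK]

/-- (Ported verbatim from the HodgeCMPerL package; no docstring in the source.) -/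
theorem thetaLift₂_ωK (χ₂ : R.DS.A₂ → ℂ) (x : R.K) (φ : R.DS.S₂) (g : R.DS.G) :
    R.DS.thetaLift₂ R.ν₂ χ₂ (R.ωK₂ x φ) g = R.DS.thetaLift₂ R.ν₂ χ₂ φ (R.ract x g) := by
  simp only [ThetaSeesawData.thetaLift₂, R.thetaKernel₂_ωK]


-- port_pkg: scope closed for this part
end QautSeesawBridge
end QautSeesaw
end PerL34
end HodgeCM
end
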